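import Summits.BirchSwinnertonDyer.BirchSwinnertonDyer.Theorems.ByReductionTypeAtTwoMultTransportRealTorsion
import Literature.NumberTheory.EllipticCurves.Greenberg1999.ControlLocalKernelsLayerAdditiveProofs
import Literature.NumberTheory.EllipticCurves.TorsionCardinality
import HarnessLib

/-!
# Route `ByReductionTypeAtTwo`, crux `MultUpperHalfAtTwo` (item stmt-BirchSwinnertonDyer-19922): ONE BIT at an odd ADDITIVE prime
# with `ord_v(Δ_min)` ODD — part 1: `Δ ∉ (K_v^nr)²` ⟹ `#E(K_v^nr)[2] ≤ 2` ⟹ the inertia-fixed `2`-torsion of `E(K̄_v)` has `≤ 2` points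

Part 1 of the lever (L1) of the seat census `mult2/gen9/NOTE-L1-Instar-odd-one-bit.md` (types `I_n*` with `n` odd, `III`, `III*` —
uniformly: `ord_v(Δ_min)` odd). THE MATHEMATICS. Let `X/K_v` be an elliptic curve with an integral equation whose discriminant `Δ₀` has
ODD valuation, `v ∤ 2`. (i) `Δ₀` is not a square in the maximal unramified extension `K_v^nr`: its valuation ring `𝒪ⁿʳ` is a
discrete valuation ring with the SAME uniformiser (tree `isDiscreteValuationRing_unrIntegers`, `map_mem_maximalIdeal_pow_iff`: `e = 1`),
and a square `r²` has even valuation (`even_of_mul_self_mem_pow`). (ii) Over ANY field with `2 ≠ 0`, two distinct roots `e₁ ≠ e₂`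
of the `2`-division cubic `4X³ + b₂X² + 2b₄X + b₆` force `16Δ = ((e₁−e₂)(b₂+8e₁+4e₂)(b₂+4e₁+8e₂))²` — the third root is rational and the
discriminant of the cubic is `16Δ` (Silverman *AEC* III.1; the ordered-field twin is t42's `MultTransportAtTwo.Δ_nonneg_of_two_roots`) —
so `Δ ∉ F²` ⟹ at most one root ⟹ `#E(F)[2] ≤ 2` (t42's `natCard_torsionBy_two_le_two_of_roots`). (iii) The points of `X(K̄_v)` fixed
by the inertia group `I_𝔐` and killed by `2` come from `X(K_v^nr)[2]` (tree `exists_map_maxUnramified_eq_of_forall_inertia`), hence are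
at most `2`. Part 2 (`…MultTowerLocalAddvOddOrd`) turns this into «`E(K̄_v)^I[2^∞]` is CYCLIC» (it has order `≤ 4` at an additive
place: tree `finite_and_natCard_inertiaFixed_primary_le_four_of_hasAdditiveReduction`) and «`𝒦_{v,n}[2^∞]` is cyclic» (a subquotient,
Greenberg LNM 1716 pp. 87–88), i.e. `#𝒦_{v,n}[2] ≤ 2`: ONE bit.
HONEST FRAMING (cell `bsd-2adic`, run/shared/lean/pub/bsd-2adic/, seat `bsd-2adic-mult-2` GEN 10, HUMAN RULINGS D-0036 / D-0054 /
D-0074 row (A)): research route; THEOREMS ONLY — no definition, no new named fact; nothing is booked; BSD is not proved by any of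
this. PARTITION: X5@2 mult (K4ᵐ, RESIDUAL-MAP B1·O1; the 434 `E[2]`-irreducible classes without class file after GEN 9) × p = 2 —
types-the-object-of (the per-prime local constant of the TOWER-gap certificate of item 19922 at an odd additive prime with odd
`ord Δ_min`); closes none. WHAT IS DISPLAYED, NOT PROVED: nothing. ∀-LEVEL CONTENT: none.
References: R. Greenberg, LNM 1716 (1999), §3 Lemma 3.3 (pp. 86–88); J. H. Silverman, *AEC* (2009) III.1, III.2.3(d), Ex. 3.7,
VII.6.1; *ATAEC* (1994) IV.9 Table 4.1 (`I_n*`: `Φ(k̄) = ℤ/4ℤ` for `n` odd); J. Neukirch, *ANT* II (7.5), (9.11).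
-/

set_option autoImplicit false
-- the Theorems namespace of this sub repeats the summit name by design (D-0017 nested layout: Summit.<S>.<Sub>)
set_option linter.dupNamespace false

noncomputable section

open scoped Classical NNReal
open NumberField IsDedekindDomain Field Polynomial IsLocalRing

universe u

/-! ## §0 Pure algebra -/

namespace Summit.BirchSwinnertonDyer.BirchSwinnertonDyer.Theorems.MultTowerOddOrd

section Field

variable {F : Type*} [Field F] (V : WeierstrassCurve F)

/-- **Two distinct rational roots of the `2`-division cubic make `Δ` a square** (any field with `2 ≠ 0`): if `e₁ ≠ e₂` are roots
of `4X³ + b₂X² + 2b₄X + b₆` then the third root `s = −b₂/4 − e₁ − e₂` is rational and `16Δ = ((e₁−e₂)(b₂+8e₁+4e₂)(b₂+4e₁+8e₂))²`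
(`= (16(e₁−e₂)(e₁−s)(e₂−s))²`; the discriminant of the `2`-division cubic is `16Δ`, Silverman *AEC* III.1), so `Δ = (·/4)²`.
The algebra is that of t42's `MultTransportAtTwo.Δ_nonneg_of_two_roots`, division-free. [cite: SilvermanAEC2009, III.1 and Ex. 3.7] -/
theorem isSquare_Δ_of_two_roots (h2 : (2 : F) ≠ 0) {e₁ e₂ : F} (hne : e₁ ≠ e₂)
    (h₁ : 4 * e₁ ^ 3 + V.b₂ * e₁ ^ 2 + 2 * V.b₄ * e₁ + V.b₆ = 0)
    (h₂ : 4 * e₂ ^ 3 + V.b₂ * e₂ ^ 2 + 2 * V.b₄ * e₂ + V.b₆ = 0) : IsSquare V.Δ := by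
  -- `(h₁ - h₂)/(e₁ - e₂)`
  have hsub : (e₁ - e₂) * (4 * (e₁ ^ 2 + e₁ * e₂ + e₂ ^ 2) + V.b₂ * (e₁ + e₂) + 2 * V.b₄) = 0 := by
    linear_combination h₁ - h₂
  have hi : 4 * (e₁ ^ 2 + e₁ * e₂ + e₂ ^ 2) + V.b₂ * (e₁ + e₂) + 2 * V.b₄ = 0 :=
    (mul_eq_zero.mp hsub).resolve_left (sub_ne_zero.mpr hne)
  -- `2b₄` and `b₆` as polynomials in `e₁, e₂, b₂`
  have hB : 2 * V.b₄ = -4 * (e₁ ^ 2 + e₁ * e₂ + e₂ ^ 2) - V.b₂ * (e₁ + e₂) := by linear_combination hi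
  have hb₆ : V.b₆ = -4 * e₁ ^ 3 - V.b₂ * e₁ ^ 2 - (-4 * (e₁ ^ 2 + e₁ * e₂ + e₂ ^ 2) - V.b₂ * (e₁ + e₂)) * e₁ := by
    linear_combination h₁ - e₁ * hB
  have h16 : 16 * V.Δ = ((e₁ - e₂) * (V.b₂ + 8 * e₁ + 4 * e₂) * (V.b₂ + 4 * e₁ + 8 * e₂)) ^ 2 := by
    rw [WeierstrassCurve.Δ]
    linear_combination (-4 * V.b₂ ^ 2) * V.b_relation +
      (V.b₂ ^ 2 * (2 * V.b₄ + (-4 * (e₁ ^ 2 + e₁ * e₂ + e₂ ^ 2) - V.b₂ * (e₁ + e₂))) -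
          16 * (4 * V.b₄ ^ 2 + 2 * V.b₄ * (-4 * (e₁ ^ 2 + e₁ * e₂ + e₂ ^ 2) - V.b₂ * (e₁ + e₂)) +
            (-4 * (e₁ ^ 2 + e₁ * e₂ + e₂ ^ 2) - V.b₂ * (e₁ + e₂)) ^ 2) +
        72 * V.b₂ * V.b₆) * hB +
      (-4 * V.b₂ ^ 3 -
          432 * (V.b₆ + (-4 * e₁ ^ 3 - V.b₂ * e₁ ^ 2 - (-4 * (e₁ ^ 2 + e₁ * e₂ + e₂ ^ 2) - V.b₂ * (e₁ + e₂)) * e₁)) +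
        72 * V.b₂ * (-4 * (e₁ ^ 2 + e₁ * e₂ + e₂ ^ 2) - V.b₂ * (e₁ + e₂))) * hb₆
  have h4 : (4 : F) ≠ 0 := by
    rw [show (4 : F) = 2 * 2 by norm_num]; exact mul_ne_zero h2 h2
  refine ⟨(e₁ - e₂) * (V.b₂ + 8 * e₁ + 4 * e₂) * (V.b₂ + 4 * e₁ + 8 * e₂) / 4, ?_⟩
  field_simp
  linear_combination h16

/-- **`#V(F)[2] ≤ 2` when `Δ` is not a square in `F`** (`2 ≠ 0` in `F`): the `2`-division cubic has at most one root
(`isSquare_Δ_of_two_roots`), and t42's `MultTransportAtTwo.natCard_torsionBy_two_le_two_of_roots`.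
[cite: SilvermanAEC2009, III.2.3(d) and Ex. 3.7] -/
theorem natCard_torsionBy_two_le_two_of_not_isSquare_Δ [DecidableEq F] (h2 : (2 : F) ≠ 0) (hΔ : ¬ IsSquare V.Δ) :
    Nat.card (AddSubgroup.torsionBy V.toAffine.Point (2 : ℤ)) ≤ 2 := by
  have h := MultTransportAtTwo.natCard_torsionBy_two_le_two_of_roots V h2 fun e₁ e₂ h₁ h₂ ↦ by
    by_contra hne
    exact hΔ (isSquare_Δ_of_two_roots V h2 hne h₁ h₂)
  convert h

end Field

section DVR

open Literature.NumberTheory.DiophantineGeometry.TateAlgorithm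

variable {R : Type*} [CommRing R] [IsDomain R] [IsDiscreteValuationRing R]

/-- **A square has even valuation**: in a discrete valuation ring, if `r·r ∈ 𝔪^k` and `r·r ∉ 𝔪^{k+1}` then `k` is even
(`ord(r²) = 2·ord(r)`). [folklore] -/
theorem even_of_mul_self_mem_pow {r : R} {k : ℕ} (hk : r * r ∈ maximalIdeal R ^ k)
    (hk' : r * r ∉ maximalIdeal R ^ (k + 1)) : Even k := by
  have hr0 : r ≠ 0 := by
    rintro rfl
    exact hk' (by rw [mul_zero]; exact Ideal.zero_mem _)
  have htop : IsDiscreteValuationRing.addVal R r ≠ ⊤ :=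
    fun h ↦ hr0 (IsDiscreteValuationRing.addVal_eq_top_iff.mp h)
  set m : ℕ := (IsDiscreteValuationRing.addVal R r).toNat with hm
  have hmval : IsDiscreteValuationRing.addVal R r = m := (ENat.coe_toNat htop).symm
  have hrr : IsDiscreteValuationRing.addVal R (r * r) = ((m + m : ℕ) : ℕ∞) := by
    rw [IsDiscreteValuationRing.addVal_mul, hmval, Nat.cast_add]
  have h1 : k ≤ m + m := by
    have h := pow_dvd_iff_le_addVal.mp (mem_maximalIdeal_pow_iff_dvd.mp hk)
    rw [hrr] at h
    exact_mod_cast h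
  have h2 : ¬ k + 1 ≤ m + m := fun hle ↦ by
    apply hk'
    refine mem_maximalIdeal_pow_iff_dvd.mpr (pow_dvd_iff_le_addVal.mpr ?_)
    rw [hrr]
    exact_mod_cast hle
  exact ⟨m, by omega⟩

end DVR

section Cyclic

/-- **A finite abelian group of order `≤ 4` with at most two elements killed by `2` is cyclic**: orders `1, 2, 3` are trivial or
prime; in order `4` an element not killed by `2` has order `4`. [folklore] -/
theorem isAddCyclic_of_natCard_le_four {B : Type*} [AddCommGroup B] [Finite B] (h4 : Nat.card B ≤ 4)
    (h2 : Nat.card {b : B // 2 • b = 0} ≤ 2) : IsAddCyclic B := by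
  have hpos : 0 < Nat.card B := Nat.card_pos
  rcases Nat.lt_or_ge (Nat.card B) 4 with hlt | hge
  · interval_cases h : Nat.card B
    · haveI : Subsingleton B := (Nat.card_eq_one_iff_unique.mp h).1
      exact isAddCyclic_of_subsingleton
    · haveI : Fact (Nat.Prime 2) := ⟨Nat.prime_two⟩
      exact isAddCyclic_of_prime_card h
    · haveI : Fact (Nat.Prime 3) := ⟨Nat.prime_three⟩
      exact isAddCyclic_of_prime_card h
  · have hcard : Nat.card B = 4 := le_antisymm h4 hge
    -- an element not killed by `2`
    have hex : ∃ b : B, 2 • b ≠ 0 := by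
      by_contra hall
      push Not at hall
      have hsurj : Function.Surjective (fun x : {b : B // 2 • b = 0} ↦ (x : B)) :=
        fun b ↦ ⟨⟨b, hall b⟩, rfl⟩
      have := Nat.card_le_card_of_surjective _ hsurj
      omega
    obtain ⟨b, hb⟩ := hex
    refine isAddCyclic_of_addOrderOf_eq_card b ?_
    have hdvd : addOrderOf b ∣ 4 := hcard ▸ addOrderOf_dvd_natCard b
    have h1 : addOrderOf b ≠ 1 := fun h ↦ hb (by rw [AddMonoid.addOrderOf_eq_one_iff.mp h, smul_zero])
    have h2' : addOrderOf b ≠ 2 := fun h ↦ hb (by rw [← h]; exact addOrderOf_nsmul_eq_zero b)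
    have hdvd' : addOrderOf b ∣ 2 ^ 2 := by simpa using hdvd
    obtain ⟨j, hj, hj'⟩ := (Nat.dvd_prime_pow Nat.prime_two).mp hdvd'
    interval_cases j <;> simp_all

/-- **A group embedded in a homomorphic image of a finite cyclic group is finite cyclic.** `ι : X ↪ Q` injective with image
inside `ρ(Z)`, `Z` finite cyclic ⟹ `X` finite cyclic (`ρ(Z)` is cyclic, a subgroup of a cyclic group is cyclic). The twin of the
tree's private `finite_isAddCyclic_natCard_dvd_of_embedding` (`ControlLocalKernelsLayerInertiaCyclicProofs`) with the datum
`λ : Z → ℤ/e` replaced by «`Z` finite cyclic». [folklore] -/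
theorem finite_isAddCyclic_of_embedding {X Q Z : Type*} [AddCommGroup X] [AddCommGroup Q] [AddCommGroup Z]
    [Finite Z] [IsAddCyclic Z] (ι : X →+ Q) (hι : Function.Injective ι) (ρ : Z →+ Q)
    (hρ : ∀ x : X, ι x ∈ ρ.range) :
    Finite X ∧ IsAddCyclic X ∧ Nat.card X ∣ Nat.card Z := by
  haveI : Finite ρ.range := Finite.of_surjective ρ.rangeRestrict ρ.rangeRestrict_surjective
  haveI : IsAddCyclic ρ.range := isAddCyclic_of_surjective ρ.rangeRestrict ρ.rangeRestrict_surjective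
  let ι' : X →+ ρ.range := ι.codRestrict ρ.range hρ
  have hι' : Function.Injective ι' := fun a b hab ↦ hι (congrArg Subtype.val hab)
  refine ⟨Finite.of_injective ι' hι', isAddCyclic_of_injective ι' hι', ?_⟩
  calc Nat.card X ∣ Nat.card ρ.range := AddSubgroup.card_dvd_of_injective ι' hι'
    _ ∣ Nat.card Z := AddSubgroup.card_dvd_of_surjective ρ.rangeRestrict ρ.rangeRestrict_surjective

/-- **In a finite cyclic group at most `2` elements are killed by `2`** (counted on the subtype; Mathlib's
`IsAddCyclic.card_nsmul_eq_zero_le` on the `Finset`). [folklore] -/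
theorem natCard_two_nsmul_eq_zero_le_two {X : Type*} [AddCommGroup X] [Finite X] [IsAddCyclic X] :
    Nat.card {x : X // 2 • x = 0} ≤ 2 := by
  classical
  haveI : Fintype X := Fintype.ofFinite X
  have h := IsAddCyclic.card_nsmul_eq_zero_le (α := X) (n := 2) two_pos
  rw [Nat.card_eq_fintype_card, Fintype.card_subtype]
  convert h using 2

end Cyclic

end Summit.BirchSwinnertonDyer.BirchSwinnertonDyer.Theorems.MultTowerOddOrd


/-! ## §1 The inertia-fixed `2`-torsion of `X(K̄_v)` has at most `2` points when `ord_v Δ` is odd -/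

namespace WeierstrassCurve

open Literature.NumberTheory.EllipticCurves Literature.NumberTheory.EllipticCurves.LocalIndex
  Literature.NumberTheory.GaloisRepresentations
  Literature.NumberTheory.GaloisRepresentations.IsNonarchimedeanLocalField
  Literature.NumberTheory.DiophantineGeometry Literature.NumberTheory.DiophantineGeometry.TateAlgorithm
  IsDedekindDomain IsDedekindDomain.HeightOneSpectrum
  Summit.BirchSwinnertonDyer.BirchSwinnertonDyer.Theorems.MultTowerOddOrd

section Local

variable {K : Type u} [Field K] [NumberField K] {v : HeightOneSpectrum (𝓞 K)}
  (X : WeierstrassCurve (v.adicCompletion K))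

set_option maxHeartbeats 1600000 in
/-- **At a place `v ∤ 2` where the integral equation has `ord_v(Δ)` ODD, the inertia-fixed points of `X(K̄_v)` killed by `2` are at most
`2`.** For `X/K_v` elliptic with an `𝓞_v`-integral equation `X₀` (`X = X₀ ⊗ K_v`), `w` the spectral valuation, `𝔐` the prime of
`\bar 𝓞_v` above `𝓂_v`: if `ord_v(Δ(X₀))` is odd then `#{P ∈ X(K̄_v) : I_𝔐 P = P, 2P = O} ≤ 2`. Proof: such `P` come from `X(K_v^nr)[2]`
(`exists_map_maxUnramified_eq_of_forall_inertia`); `Δ` is not a square in `K_v^nr` (the valuation ring `𝒪ⁿʳ` of `K_v^nr` is a DVR in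
which `𝓞_v → 𝒪ⁿʳ` preserves `𝔪`-adic orders, `map_mem_maximalIdeal_pow_iff`, and squares have even order); hence the `2`-division
cubic has at most one root in `K_v^nr` and `#X(K_v^nr)[2] ≤ 2` (`natCard_torsionBy_two_le_two_of_not_isSquare_Δ`).
[cite: SilvermanAEC2009, III.2.3(d), Ex. 3.7] [cite: SilvermanATAEC1994, IV.9 Table 4.1] [cite: NeukirchANT1999, Ch. II (7.5), (9.11)] -/
theorem finite_and_natCard_inertiaFixed_twoTorsion_le_two_of_odd_addVal [hXell : X.IsElliptic]
    [X.IsIntegral (v.adicCompletionIntegers K)]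
    (w : Valuation (AlgebraicClosure (v.adicCompletion K)) ℝ≥0)
    (hw : ∀ x, (w x : ℝ) =
      spectralNorm (v.adicCompletion K) (AlgebraicClosure (v.adicCompletion K)) x)
    {𝔐 : Ideal (localAbsIntegers v)} (h𝔐 : 𝔐 ∈ v.localPrimesAbove)
    (hodd : Odd (IsDiscreteValuationRing.addVal (v.adicCompletionIntegers K)
      (X.integralModel (v.adicCompletionIntegers K)).Δ).toNat) :
    Finite {P : (X.baseChange (AlgebraicClosure (v.adicCompletion K))).toAffine.Point //
        (∀ σ ∈ 𝔐.inertia (absoluteGaloisGroup (v.adicCompletion K)),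
          Affine.Point.map ((absoluteGaloisGroup.toAlgEquiv _ σ :
              AlgebraicClosure (v.adicCompletion K) ≃ₐ[v.adicCompletion K]
                AlgebraicClosure (v.adicCompletion K)) :
              AlgebraicClosure (v.adicCompletion K) →ₐ[v.adicCompletion K]
                AlgebraicClosure (v.adicCompletion K)) P = P) ∧
        2 • P = 0} ∧
      Nat.card {P : (X.baseChange (AlgebraicClosure (v.adicCompletion K))).toAffine.Point //
        (∀ σ ∈ 𝔐.inertia (absoluteGaloisGroup (v.adicCompletion K)),
          Affine.Point.map ((absoluteGaloisGroup.toAlgEquiv _ σ :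
              AlgebraicClosure (v.adicCompletion K) ≃ₐ[v.adicCompletion K]
                AlgebraicClosure (v.adicCompletion K)) :
              AlgebraicClosure (v.adicCompletion K) →ₐ[v.adicCompletion K]
                AlgebraicClosure (v.adicCompletion K)) P = P) ∧
        2 • P = 0} ≤ 2 := by
  classical
  haveI := isDiscreteValuationRing_unrIntegers hw
  obtain ⟨φ, hφ⟩ := exists_ringHom_adicCompletionIntegers_unrIntegers hw
  haveI : CharZero (v.adicCompletion K) := charZero_of_injective_algebraMap (algebraMap K _).injective
  haveI : CharZero (AlgebraicClosure (v.adicCompletion K)) :=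
    charZero_of_injective_algebraMap (algebraMap (v.adicCompletion K) _).injective
  haveI : CharZero (maxUnramified (v.adicCompletion K)) :=
    charZero_of_injective_algebraMap (algebraMap (v.adicCompletion K) _).injective
  -- the integral equation and its discriminant
  set X₀ := X.integralModel (v.adicCompletionIntegers K) with hX₀def
  have hX₀K : X₀.baseChange (v.adicCompletion K) = X :=
    WeierstrassCurve.baseChange_integralModel_eq (v.adicCompletionIntegers K) X
  have hΔX : X.Δ = algebraMap (v.adicCompletionIntegers K) (v.adicCompletion K) X₀.Δ := by
    conv_lhs => rw [← hX₀K]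
    exact WeierstrassCurve.map_Δ _ _
  have hΔ0 : X₀.Δ ≠ 0 := fun h0 ↦ hXell.isUnit.ne_zero (by rw [hΔX, h0, map_zero])
  -- `ord_v Δ₀ = k`
  set k : ℕ := (IsDiscreteValuationRing.addVal (v.adicCompletionIntegers K) X₀.Δ).toNat with hkdef
  have hkval : IsDiscreteValuationRing.addVal (v.adicCompletionIntegers K) X₀.Δ = k :=
    (ENat.coe_toNat fun h ↦ hΔ0 (IsDiscreteValuationRing.addVal_eq_top_iff.mp h)).symm
  have hmem : X₀.Δ ∈ maximalIdeal (v.adicCompletionIntegers K) ^ k :=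
    mem_maximalIdeal_pow_iff_dvd.mpr (pow_dvd_iff_le_addVal.mpr (by rw [hkval]))
  have hnmem : X₀.Δ ∉ maximalIdeal (v.adicCompletionIntegers K) ^ (k + 1) := fun h ↦ by
    have h' := pow_dvd_iff_le_addVal.mp (mem_maximalIdeal_pow_iff_dvd.mp h)
    rw [hkval] at h'
    have : k + 1 ≤ k := by exact_mod_cast h'
    omega
  have hmem' := (map_mem_maximalIdeal_pow_iff hw hφ X₀.Δ k).mpr hmem
  have hnmem' : φ X₀.Δ ∉ maximalIdeal (Valuation.valuationSubring (Valuation.comap (algebraMap (maxUnramified (v.adicCompletion K)) (AlgebraicClosure (v.adicCompletion K))) w)) ^ (k + 1) :=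
    fun h ↦ hnmem ((map_mem_maximalIdeal_pow_iff hw hφ X₀.Δ (k + 1)).mp h)
  -- the curve over `K_v^nr`
  set V := X.baseChange (maxUnramified (v.adicCompletion K)) with hVdef
  have h2L : (2 : maxUnramified (v.adicCompletion K)) ≠ 0 := two_ne_zero
  have hVΔ : V.Δ = algebraMap (v.adicCompletion K) (maxUnramified (v.adicCompletion K)) X.Δ :=
    WeierstrassCurve.map_Δ _ _
  -- (i) `Δ` is not a square in `K_v^nr`
  have hnsq : ¬ IsSquare V.Δ := by
    rintro ⟨r, hr⟩
    have hΔint : w (algebraMap (v.adicCompletion K) (AlgebraicClosure (v.adicCompletion K)) X.Δ) ≤ 1 :=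
      (spectralValuation_algebraMap_le_one_iff hw _).mpr (by rw [hΔX]; exact SetLike.coe_mem _)
    have hcoe : (((r * r : maxUnramified (v.adicCompletion K))) : AlgebraicClosure (v.adicCompletion K)) =
        algebraMap (v.adicCompletion K) (AlgebraicClosure (v.adicCompletion K)) X.Δ := by
      rw [← hr, hVΔ]
      exact IntermediateField.coe_algebraMap_apply (S := maxUnramified (v.adicCompletion K)) X.Δ
    have hr1 : w (r : AlgebraicClosure (v.adicCompletion K)) ≤ 1 := by
      by_contra hlt
      rw [not_le] at hlt
      have h2 : 1 * 1 < w (r : AlgebraicClosure (v.adicCompletion K)) * w (r : AlgebraicClosure (v.adicCompletion K)) :=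
        mul_lt_mul'' hlt hlt zero_le_one zero_le_one
      rw [one_mul, ← map_mul] at h2
      have : ((r : AlgebraicClosure (v.adicCompletion K)) * (r : AlgebraicClosure (v.adicCompletion K))) =
          (((r * r : maxUnramified (v.adicCompletion K))) : AlgebraicClosure (v.adicCompletion K)) := by
        push_cast; rfl
      rw [this, hcoe] at h2
      exact absurd hΔint (not_le.mpr h2)
    have hrmem : r ∈ Valuation.valuationSubring (Valuation.comap (algebraMap (maxUnramified (v.adicCompletion K)) (AlgebraicClosure (v.adicCompletion K))) w) :=
      (Valuation.mem_valuationSubring_iff _ _).mpr hr1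
    set r' : Valuation.valuationSubring (Valuation.comap (algebraMap (maxUnramified (v.adicCompletion K)) (AlgebraicClosure (v.adicCompletion K))) w) := ⟨r, hrmem⟩ with hr'def
    have hsq : φ X₀.Δ = r' * r' := by
      apply Subtype.ext
      apply Subtype.ext
      change (((φ X₀.Δ : Valuation.valuationSubring (Valuation.comap (algebraMap (maxUnramified (v.adicCompletion K)) (AlgebraicClosure (v.adicCompletion K))) w)) : maxUnramified (v.adicCompletion K)) : AlgebraicClosure (v.adicCompletion K)) =
        (((r * r : maxUnramified (v.adicCompletion K))) : AlgebraicClosure (v.adicCompletion K))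
      rw [hφ, hcoe, hΔX]
      rfl
    rw [hsq] at hmem' hnmem'
    exact (Nat.not_even_iff_odd.mpr hodd) (even_of_mul_self_mem_pow hmem' hnmem')
  -- (ii) `#X(K_v^nr)[2] ≤ 2`, and `X(K_v^nr)[2]` is finite (it embeds in `X(K̄_v)[2]`, of order `4`)
  have hT2 : Nat.card (AddSubgroup.torsionBy V.toAffine.Point (2 : ℤ)) ≤ 2 :=
    natCard_torsionBy_two_le_two_of_not_isSquare_Δ V h2L hnsq
  set ι : V.toAffine.Point →+ (X.baseChange (AlgebraicClosure (v.adicCompletion K))).toAffine.Point :=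
    WeierstrassCurve.Affine.Point.map (W' := X)
      (IsScalarTower.toAlgHom (v.adicCompletion K) (maxUnramified (v.adicCompletion K)) (AlgebraicClosure (v.adicCompletion K))) with hι
  have hinjι : Function.Injective ι := by rw [hι]; exact WeierstrassCurve.Affine.Point.map_injective _
  have hmemT : ∀ {M : Type u} [AddCommGroup M] (P : M), P ∈ AddSubgroup.torsionBy M (2 : ℤ) ↔ P + P = 0 := by
    intro M _ P
    rw [Submodule.mem_toAddSubgroup, Submodule.mem_torsionBy_iff, two_zsmul]
  haveI hfin4 : Finite (AddSubgroup.torsionBy (X.baseChange (AlgebraicClosure (v.adicCompletion K))).toAffine.Point (2 : ℤ)) := by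
    refine Nat.finite_of_card_ne_zero ?_
    have h2K : ((2 : ℕ) : AlgebraicClosure (v.adicCompletion K)) ≠ 0 := by
      rw [Nat.cast_ofNat]; exact two_ne_zero
    have h4 := WeierstrassCurve.card_torsionBy_eq_sq (E := X.baseChange (AlgebraicClosure (v.adicCompletion K))) h2K
    simp only [Nat.cast_ofNat] at h4
    rw [h4]
    norm_num
  let ιT : AddSubgroup.torsionBy V.toAffine.Point (2 : ℤ) →
      AddSubgroup.torsionBy (X.baseChange (AlgebraicClosure (v.adicCompletion K))).toAffine.Point (2 : ℤ) :=
    fun Q ↦ ⟨ι Q, by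
      have hQ := (hmemT (Q : V.toAffine.Point)).mp Q.2
      rw [hmemT, ← map_add, hQ, map_zero]⟩
  have hιT : Function.Injective ιT := fun a b hab ↦ Subtype.ext (hinjι (congrArg Subtype.val hab))
  haveI : Finite (AddSubgroup.torsionBy V.toAffine.Point (2 : ℤ)) := Finite.of_injective ιT hιT
  -- (iii) the `I_𝔐`-fixed `2`-torsion points of `X(K̄_v)` come from `X(K_v^nr)[2]`
  have hsurj : ∀ P : (X.baseChange (AlgebraicClosure (v.adicCompletion K))).toAffine.Point,
      (∀ σ ∈ 𝔐.inertia (absoluteGaloisGroup (v.adicCompletion K)),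
        WeierstrassCurve.Affine.Point.map
          ((absoluteGaloisGroup.toAlgEquiv _ σ : (AlgebraicClosure (v.adicCompletion K)) ≃ₐ[(v.adicCompletion K)] (AlgebraicClosure (v.adicCompletion K))) : (AlgebraicClosure (v.adicCompletion K)) →ₐ[(v.adicCompletion K)] (AlgebraicClosure (v.adicCompletion K))) P = P) →
        ∃ Q, ι Q = P := fun P hP ↦ by
    rw [hι]; exact X.exists_map_maxUnramified_eq_of_forall_inertia w hw h𝔐 P hP
  have hlift : ∀ P : {P : (X.baseChange (AlgebraicClosure (v.adicCompletion K))).toAffine.Point //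
        (∀ σ ∈ 𝔐.inertia (absoluteGaloisGroup (v.adicCompletion K)),
          Affine.Point.map ((absoluteGaloisGroup.toAlgEquiv _ σ :
              AlgebraicClosure (v.adicCompletion K) ≃ₐ[v.adicCompletion K]
                AlgebraicClosure (v.adicCompletion K)) :
              AlgebraicClosure (v.adicCompletion K) →ₐ[v.adicCompletion K]
                AlgebraicClosure (v.adicCompletion K)) P = P) ∧
        2 • P = 0},
      ∃ Q : AddSubgroup.torsionBy V.toAffine.Point (2 : ℤ), ι (Q : V.toAffine.Point) = (P : _) := by
    rintro ⟨P, hPI, hP2⟩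
    obtain ⟨Q, hQ⟩ := hsurj P hPI
    refine ⟨⟨Q, ?_⟩, hQ⟩
    rw [hmemT]
    apply hinjι
    rw [map_add, hQ, map_zero, ← two_nsmul, hP2]
  choose f hf using hlift
  have hfinj : Function.Injective f := fun P₁ P₂ h ↦ Subtype.ext (by rw [← hf P₁, ← hf P₂, h])
  exact ⟨Finite.of_injective f hfinj, (Nat.card_le_card_of_injective f hfinj).trans hT2⟩

end Local

end WeierstrassCurve

end
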